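import Summits.Ventures.HodgeRepro2.T5SU11ResolventEnergy
import Summits.Ventures.HodgeRepro2.T5SU11SphericalXiAsymptotic

/-!
# The ground-state transform: `sinh 2t (u′)² − sinh 2t u² = sinh 2t Ξ² (u/Ξ)′² + (sinh 2t Ξ′ u²/Ξ)′`

The Harish-Chandra function `Ξ = φ_1` is a positive solution of the radial equation at the bottom of the spectrum,
`(sinh 2t Ξ′)′ = −sinh 2t Ξ` (`μ = 1·(1−2) = −1`). Writing `u = Ξ w` (the ground-state transform), the Dirichlet
integrand decomposes as

  **`sinh 2t (u′)² = sinh 2t u² + sinh 2t (u′Ξ − uΞ′)²/Ξ² + H(u)′`, `H(u) = sinh 2t Ξ′ u²/Ξ`**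
  (`hasDerivAt_hardyBracket`; `(u′Ξ − uΞ′)/Ξ² = w′`),

so that on `[ε, R] ⊂ (0, ∞)` **`∫_ε^R sinh 2t (u′)² − ∫_ε^R sinh 2t u² ≥ H(u)(R) − H(u)(ε)`**
(`hardy_identity_inhom`, `hardy_ineq_interval`). For `u = G_λ f` (`λ > 1`, `f` continuous and supported in
`[a, b]`): **`H(ε) → 0`** as `ε → 0⁺` (`tendsto_hardyBracket_left`) and **`H(R) → 0`** as `R → ∞`
(`tendsto_hardyBracket_right`): with `sinh 2R Ξ′(R) = −∫_0^R sinh 2s Ξ` (row 473), `Ξ(s) ≤ (α + βs)e^{−s}` and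
`Ξ(R) ≥ (4/π) R e^{−R}` (row 35x), `|H(R)| ≤ (π/2) c₂² L² (α + βR) e^{(2−2λ)R}`. The Hardy inequality
`∫_0^∞ sinh 2t (G_λ f)′² ≥ ∫_0^∞ sinh 2t (G_λ f)²` follows in the next row. Nothing is claimed about (N).

Blind lane: Mathlib + the HodgeRepro2 prefix only; no sorry; axioms ⊆ {propext, Classical.choice,
Quot.sound}.
-/

namespace Summit.Ventures.HodgeRepro2.T5SU11GroundStateTransform

open Filter Topology MeasureTheory intervalIntegral
open Set (Ioi Ioc Icc uIcc)
open scoped Real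
open T5SU11Cartan T5SU11SphericalFunction T5SU11SphericalBounds T5SU11SphericalContinuous
  T5SU11SphericalSolutionSpaceAll T5SU11SphericalDecay T5SU11SphericalDecayAsymptotic
  T5SU11SphericalXiAsymptotic T5SU11RadialGreen T5SU11SphericalGreen T5SU11ResolventBoundary
  T5SU11ResolventTransform T5SU11SphericalDecayBracket T5SU11ResolventEnergyPieces T5SU11ResolventEnergy
  T5SU11SphericalLegendreHigher T5SU11ReductionOfOrder T5SU11SphericalAsymptotic T5SU11SphericalCfun

section measure

variable [MeasurableSpace Circle] [BorelSpace Circle]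

/-- **The ground-state bracket** `H(u)(t) = sinh 2t · Ξ′(t) · u(t)² / Ξ(t)`, `Ξ = φ_1`. -/
noncomputable def hardyBracket (u : ℝ → ℝ) (t : ℝ) : ℝ :=
  Real.sinh (2 * t) * deriv (fun t => sph 1 (hyp t)) t * u t ^ 2 / sph 1 (hyp t)

/-- **The ground-state identity**: `H(u)′ = sinh 2t (u′)² − sinh 2t u² − sinh 2t (u′Ξ − uΞ′)²/Ξ²`. -/
theorem hasDerivAt_hardyBracket {u u' : ℝ → ℝ} {t : ℝ} (ht : 0 < t) (hu : HasDerivAt u (u' t) t) :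
    HasDerivAt (hardyBracket u)
      (Real.sinh (2 * t) * u' t ^ 2 - Real.sinh (2 * t) * u t ^ 2
        - Real.sinh (2 * t) * (u' t * sph 1 (hyp t) - u t * deriv (fun t => sph 1 (hyp t)) t) ^ 2
          / sph 1 (hyp t) ^ 2) t := by
  have hΞ : 0 < sph 1 (hyp t) := sph_hyp_pos 1 t
  have h := (((hasDerivAt_sinh_two_mul_self t).mul (hasDerivAt_deriv_sph_hyp 1 t)).mul (hu.pow 2)).div
    (hasDerivAt_sph_hyp_deriv 1 t) hΞ.ne'
  refine h.congr_deriv ?_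
  simp only [Pi.mul_apply, Pi.pow_apply]
  have e := hode_sph 1 t ht
  field_simp
  linear_combination (u t ^ 2 * sph 1 (hyp t)) * e

/-! ### The identity and the inequality on `[ε, R]` -/

section

variable {u u' : ℝ → ℝ} (hu : ∀ t, 0 < t → HasDerivAt u (u' t) t) (hcu' : ContinuousOn u' (Ioi 0))

include hu hcu' in
/-- **`∫_ε^R (sinh 2t (u′)² − sinh 2t u² − sinh 2t (u′Ξ − uΞ′)²/Ξ²) = H(R) − H(ε)`** on `[ε, R] ⊂ (0, ∞)`. -/
theorem hardy_identity_inhom {ε R : ℝ} (hε : 0 < ε) (hεR : ε ≤ R) :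
    ∫ t in ε..R, (Real.sinh (2 * t) * u' t ^ 2 - Real.sinh (2 * t) * u t ^ 2
        - Real.sinh (2 * t) * (u' t * sph 1 (hyp t) - u t * deriv (fun t => sph 1 (hyp t)) t) ^ 2 / sph 1 (hyp t) ^ 2)
      = hardyBracket u R - hardyBracket u ε := by
  have hR : 0 < R := lt_of_lt_of_le hε hεR
  have hsub : uIcc ε R ⊆ Ioi 0 := uIcc_subset_Ioi hε hR
  have hcu : ContinuousOn u (Ioi 0) := fun t ht => (hu t ht).continuousAt.continuousWithinAt
  have hcs : ContinuousOn (fun t => Real.sinh (2 * t)) (Ioi 0) :=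
    (Real.continuous_sinh.comp (continuous_const.mul continuous_id)).continuousOn
  have hΞ : Continuous fun t => sph 1 (hyp t) := continuous_sph_hyp 1
  have hΞ' : Continuous (deriv fun t => sph 1 (hyp t)) :=
    continuous_iff_continuousAt.mpr fun t => (hasDerivAt_deriv_sph_hyp 1 t).continuousAt
  have hint : IntervalIntegrable (fun t => Real.sinh (2 * t) * u' t ^ 2 - Real.sinh (2 * t) * u t ^ 2
      - Real.sinh (2 * t) * (u' t * sph 1 (hyp t) - u t * deriv (fun t => sph 1 (hyp t)) t) ^ 2 / sph 1 (hyp t) ^ 2) volume ε R := by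
    refine (ContinuousOn.mono ?_ hsub).intervalIntegrable
    refine ((hcs.mul (hcu'.pow 2)).sub (hcs.mul (hcu.pow 2))).sub ?_
    refine (hcs.mul (((hcu'.mul hΞ.continuousOn).sub (hcu.mul hΞ'.continuousOn)).pow 2)).div
      (hΞ.continuousOn.pow 2) (fun t _ => ?_)
    exact pow_ne_zero 2 (sph_hyp_pos 1 t).ne'
  exact integral_eq_sub_of_hasDerivAt (fun t ht => hasDerivAt_hardyBracket (hsub ht) (hu t (hsub ht))) hint

include hu hcu' in
/-- **The Hardy inequality on `[ε, R]`**: `∫_ε^R sinh 2t u² ≤ ∫_ε^R sinh 2t (u′)² − (H(R) − H(ε))`. -/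
theorem hardy_ineq_interval {ε R : ℝ} (hε : 0 < ε) (hεR : ε ≤ R) :
    ∫ t in ε..R, Real.sinh (2 * t) * u t ^ 2
      ≤ (∫ t in ε..R, Real.sinh (2 * t) * u' t ^ 2) - (hardyBracket u R - hardyBracket u ε) := by
  have hR : 0 < R := lt_of_lt_of_le hε hεR
  have hsub : uIcc ε R ⊆ Ioi 0 := uIcc_subset_Ioi hε hR
  have hcu : ContinuousOn u (Ioi 0) := fun t ht => (hu t ht).continuousAt.continuousWithinAt
  have hcs : ContinuousOn (fun t => Real.sinh (2 * t)) (Ioi 0) :=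
    (Real.continuous_sinh.comp (continuous_const.mul continuous_id)).continuousOn
  have hΞ : Continuous fun t => sph 1 (hyp t) := continuous_sph_hyp 1
  have hΞ' : Continuous (deriv fun t => sph 1 (hyp t)) :=
    continuous_iff_continuousAt.mpr fun t => (hasDerivAt_deriv_sph_hyp 1 t).continuousAt
  have hA : IntervalIntegrable (fun t => Real.sinh (2 * t) * u' t ^ 2) volume ε R :=
    ((hcs.mul (hcu'.pow 2)).mono hsub).intervalIntegrable
  have hB : IntervalIntegrable (fun t => Real.sinh (2 * t) * u t ^ 2) volume ε R :=
    ((hcs.mul (hcu.pow 2)).mono hsub).intervalIntegrable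
  have hQ : IntervalIntegrable (fun t => Real.sinh (2 * t) * (u' t * sph 1 (hyp t) - u t * deriv (fun t => sph 1 (hyp t)) t) ^ 2 / sph 1 (hyp t) ^ 2) volume ε R := by
    refine (ContinuousOn.mono ?_ hsub).intervalIntegrable
    refine (hcs.mul (((hcu'.mul hΞ.continuousOn).sub (hcu.mul hΞ'.continuousOn)).pow 2)).div
      (hΞ.continuousOn.pow 2) (fun t _ => ?_)
    exact pow_ne_zero 2 (sph_hyp_pos 1 t).ne'
  have hQnn : 0 ≤ ∫ t in ε..R, Real.sinh (2 * t) * (u' t * sph 1 (hyp t) - u t * deriv (fun t => sph 1 (hyp t)) t) ^ 2 / sph 1 (hyp t) ^ 2 := by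
    refine integral_nonneg hεR (fun t ht => ?_)
    have ht0 : 0 < t := lt_of_lt_of_le hε ht.1
    exact div_nonneg (mul_nonneg (sinh_two_mul_pos ht0).le (sq_nonneg _)) (sq_nonneg _)
  have h := hardy_identity_inhom hu hcu' hε hεR
  rw [integral_sub (hA.sub hB) hQ, integral_sub hA hB] at h
  linarith

end
/-! ### The boundary terms for `u = G_λ f` -/

variable {lam a b : ℝ} {f : ℝ → ℝ} (hlam : 1 < lam) (hf : ContinuousOn f (Ioi 0))
  (ha : 0 < a) (hab : a ≤ b) (hfa : ∀ s, s ≤ a → f s = 0) (hfb : ∀ s, b ≤ s → f s = 0)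

include hlam hf ha hab hfa in
/-- **`H(ε) → 0` as `ε → 0⁺`**: on `(0, a]`, `H = sinh 2ε Ξ′(ε) c₁² φ_λ(a_ε)²/Ξ(ε)`. -/
theorem tendsto_hardyBracket_left :
    Tendsto (hardyBracket (sphGreen lam f a b)) (𝓝[>] 0) (𝓝 0) := by
  set c₁ := ∫ s in a..b, sphDecay lam s * f s * Real.sinh (2 * s) with hc₁
  have hΞ' : Continuous (deriv fun t => sph 1 (hyp t)) :=
    continuous_iff_continuousAt.mpr fun t => (hasDerivAt_deriv_sph_hyp 1 t).continuousAt
  have hcont : Continuous fun ε => Real.sinh (2 * ε) * deriv (fun t => sph 1 (hyp t)) ε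
      * (-c₁ * sph lam (hyp ε)) ^ 2 / sph 1 (hyp ε) :=
    (((Real.continuous_sinh.comp (continuous_const.mul continuous_id)).mul hΞ').mul
      ((continuous_const.mul (continuous_sph_hyp lam)).pow 2)).div (continuous_sph_hyp 1)
      (fun t => (sph_hyp_pos 1 t).ne')
  have h0 := hcont.tendsto 0
  simp only [mul_zero, Real.sinh_zero, zero_mul, zero_div] at h0
  refine (h0.mono_left (nhdsWithin_le_nhds (s := Ioi 0))).congr' ?_
  filter_upwards [Ioo_mem_nhdsGT ha] with ε hε
  unfold hardyBracket
  rw [(sphGreen_of_le (lam := lam) (lam' := (1 + lam) / 2) (by linarith) (by linarith) hf ha hab hfa hε.1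
    hε.2.le).1]

/-- The linear bound `e^t Ξ(a_t) ≤ α + β t` (`t ≥ 0`) with non-negative constants (row 35x, `δ = 1`). -/
theorem exists_exp_mul_sph_one_hyp_le :
    ∃ α β : ℝ, 0 ≤ α ∧ 0 ≤ β ∧ ∀ t, 0 ≤ t → Real.exp t * sph 1 (hyp t) ≤ α + β * t := by
  refine ⟨max 0 ((2 * π)⁻¹ * (2 * (π - 1) / Real.sin (1 / 2) + 4 * (1 - 1 ^ 2 / 8)⁻¹ * Real.log (1 + 1))),
    max 0 (4 / π * (1 - 1 ^ 2 / 8)⁻¹), le_max_left _ _, le_max_left _ _, fun t ht => ?_⟩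
  have h := exp_mul_sph_one_hyp_le_linear (δ := 1) one_pos (by norm_num) ht
  calc Real.exp t * sph 1 (hyp t) ≤ _ := h
    _ ≤ _ := add_le_add (le_max_right _ _) (mul_le_mul_of_nonneg_right (le_max_right _ _) ht)

/-- `∫_0^R sinh 2t Ξ(a_t) dt ≤ R (α + βR) e^R / 2` for `R ≥ 0`, given `e^t Ξ ≤ α + βt`. -/
theorem integral_sinh_mul_sph_one_le {α β : ℝ} (hα : 0 ≤ α) (hβ : 0 ≤ β)
    (hΞ : ∀ t, 0 ≤ t → Real.exp t * sph 1 (hyp t) ≤ α + β * t) {R : ℝ} (hR : 0 ≤ R) :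
    ∫ t in (0 : ℝ)..R, Real.sinh (2 * t) * sph 1 (hyp t) ≤ R * ((α + β * R) * Real.exp R / 2) := by
  have hnn : 0 ≤ ∫ t in (0 : ℝ)..R, Real.sinh (2 * t) * sph 1 (hyp t) :=
    integral_nonneg hR (fun t ht => sinh_mul_sph_hyp_nonneg 1 ht.1)
  have hM : ∀ t ∈ Set.uIoc 0 R, ‖Real.sinh (2 * t) * sph 1 (hyp t)‖ ≤ (α + β * R) * Real.exp R / 2 := by
    intro t ht
    rw [Set.uIoc_of_le hR] at ht
    have ht0 : 0 ≤ t := ht.1.le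
    rw [Real.norm_eq_abs, abs_of_nonneg (sinh_mul_sph_hyp_nonneg 1 ht0)]
    have hs : Real.sinh (2 * t) ≤ Real.exp (2 * t) / 2 := sinh_le_exp_div_two _
    have hE : 0 < Real.exp t := Real.exp_pos t
    have hΞt : sph 1 (hyp t) ≤ (α + β * t) * Real.exp (-t) := by
      rw [Real.exp_neg, ← div_eq_mul_inv, le_div_iff₀ hE, mul_comm]
      exact hΞ t ht0
    have h1 : (α + β * t) ≤ α + β * R := by nlinarith [ht.2]
    have hexp : Real.exp t ≤ Real.exp R := Real.exp_le_exp.mpr ht.2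
    calc Real.sinh (2 * t) * sph 1 (hyp t)
        ≤ (Real.exp (2 * t) / 2) * ((α + β * t) * Real.exp (-t)) :=
          mul_le_mul hs hΞt (sph_hyp_pos 1 t).le (by positivity)
      _ = (α + β * t) * Real.exp t / 2 := by
          rw [show Real.exp (2 * t) = Real.exp t * Real.exp t by rw [← Real.exp_add]; ring_nf, Real.exp_neg]
          field_simp
      _ ≤ (α + β * R) * Real.exp R / 2 := by
          have : 0 ≤ α + β * t := by positivity
          gcongr
  have hnorm := norm_integral_le_of_norm_le_const hM
  rw [Real.norm_eq_abs, abs_of_nonneg hnn, sub_zero, abs_of_nonneg hR] at hnorm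
  linarith

include hlam hf ha hab hfb in
/-- **`H(R) → 0` as `R → ∞`**: `|H(R)| ≤ (π/2) c₂² L² (α + βR) e^{(2−2λ)R}` for `u = −c₂ χ_λ` on `[b, ∞)`. -/
theorem tendsto_hardyBracket_right :
    Tendsto (hardyBracket (sphGreen lam f a b)) atTop (𝓝 0) := by
  set c₂ := ∫ s in a..b, sph lam (hyp s) * f s * Real.sinh (2 * s) with hc₂
  set L := 1 / ((lam - 1) * cfun (2 - lam)) with hL
  have hLpos : 0 < L := sphDecay_limit_pos hlam
  obtain ⟨α, β, hα, hβ, hΞle⟩ := exists_exp_mul_sph_one_hyp_le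
  obtain ⟨T₀, hT₀⟩ := eventually_atTop.mp (eventually_sphDecay_le hlam)
  have hπ := Real.pi_pos
  have hbound : ∀ᶠ R in atTop, |hardyBracket (sphGreen lam f a b) R|
      ≤ π / 2 * (c₂ ^ 2 * L ^ 2) * ((α + β * R) * Real.exp (-(2 * lam - 2) * R)) := by
    filter_upwards [eventually_ge_atTop b, eventually_ge_atTop T₀, eventually_gt_atTop 0] with R hbR hTR hR0
    unfold hardyBracket
    rw [(sphGreen_of_ge hf ha hab hfb hbR).1]
    have hdiv := sinh_mul_deriv_sph_hyp_eq 1 R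
    have hI0 : 0 ≤ ∫ t in (0 : ℝ)..R, Real.sinh (2 * t) * sph 1 (hyp t) :=
      integral_nonneg hR0.le (fun t ht => sinh_mul_sph_hyp_nonneg 1 ht.1)
    have hI := integral_sinh_mul_sph_one_le hα hβ hΞle hR0.le
    have hΞR : 4 / π * R * Real.exp (-R) ≤ sph 1 (hyp R) := div_mul_exp_le_sph_one_hyp R
    have hΞpos : 0 < sph 1 (hyp R) := sph_hyp_pos 1 R
    have hχ := hT₀ R hTR
    have hχ0 : 0 ≤ sphDecay lam R := (sphDecay_pos hlam hR0).le
    have hE : 0 < Real.exp R := Real.exp_pos R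
    have hE' : 0 < Real.exp (-lam * R) := Real.exp_pos _
    have hden : 0 < 4 / π * R * Real.exp (-R) := by positivity
    -- `|H| = I · (c₂ χ)² / Ξ`
    have hH : Real.sinh (2 * R) * deriv (fun t => sph 1 (hyp t)) R * (-c₂ * sphDecay lam R) ^ 2 / sph 1 (hyp R)
        = -((∫ t in (0 : ℝ)..R, Real.sinh (2 * t) * sph 1 (hyp t)) * ((c₂ * sphDecay lam R) ^ 2 / sph 1 (hyp R))) := by
      rw [show Real.sinh (2 * R) * deriv (fun t => sph 1 (hyp t)) R * (-c₂ * sphDecay lam R) ^ 2 / sph 1 (hyp R)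
          = (Real.sinh (2 * R) * deriv (fun t => sph 1 (hyp t)) R)
            * ((-c₂ * sphDecay lam R) ^ 2 / sph 1 (hyp R)) by ring, hdiv]
      ring
    rw [hH, abs_neg, abs_of_nonneg (mul_nonneg hI0 (div_nonneg (sq_nonneg _) hΞpos.le))]
    -- the three bounds
    have hsq : (c₂ * sphDecay lam R) ^ 2 ≤ c₂ ^ 2 * (2 * L * Real.exp (-lam * R)) ^ 2 := by
      rw [mul_pow]
      exact mul_le_mul_of_nonneg_left (pow_le_pow_left₀ hχ0 hχ 2) (sq_nonneg _)
    have hfrac : (c₂ * sphDecay lam R) ^ 2 / sph 1 (hyp R)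
        ≤ c₂ ^ 2 * (2 * L * Real.exp (-lam * R)) ^ 2 / (4 / π * R * Real.exp (-R)) :=
      div_le_div₀ (by positivity) hsq hden hΞR
    calc (∫ t in (0 : ℝ)..R, Real.sinh (2 * t) * sph 1 (hyp t)) * ((c₂ * sphDecay lam R) ^ 2 / sph 1 (hyp R))
        ≤ (R * ((α + β * R) * Real.exp R / 2))
          * (c₂ ^ 2 * (2 * L * Real.exp (-lam * R)) ^ 2 / (4 / π * R * Real.exp (-R))) :=
          mul_le_mul hI hfrac (div_nonneg (sq_nonneg _) hΞpos.le) (by positivity)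
      _ = π / 2 * (c₂ ^ 2 * L ^ 2) * ((α + β * R) * Real.exp (-(2 * lam - 2) * R)) := by
          rw [show Real.exp (-(2 * lam - 2) * R)
              = Real.exp R * Real.exp R * (Real.exp (-lam * R) * Real.exp (-lam * R)) by
              rw [← Real.exp_add, ← Real.exp_add, ← Real.exp_add]; congr 1; ring, Real.exp_neg]
          field_simp
          ring
  have hup : Tendsto (fun R => π / 2 * (c₂ ^ 2 * L ^ 2) * ((α + β * R) * Real.exp (-(2 * lam - 2) * R)))
      atTop (𝓝 0) := by
    have hA : Tendsto (fun R : ℝ => Real.exp (-(2 * lam - 2) * R)) atTop (𝓝 0) := by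
      have := Real.tendsto_exp_atBot.comp (tendsto_id.const_mul_atTop_of_neg (by linarith : -(2 * lam - 2) < 0))
      simpa only [Function.comp_def, id] using this
    have hB := tendsto_mul_exp_neg_mul_atTop (by linarith : 0 < 2 * lam - 2)
    have := ((hA.const_mul α).add (hB.const_mul β)).const_mul (π / 2 * (c₂ ^ 2 * L ^ 2))
    simp only [mul_zero, add_zero] at this
    refine this.congr' (Filter.Eventually.of_forall fun R => ?_)
    ring
  exact squeeze_zero_norm' (hbound.mono fun R h => by rwa [Real.norm_eq_abs]) hup

end measure

end Summit.Ventures.HodgeRepro2.T5SU11GroundStateTransform
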